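import Literature.NumberTheory.Sieve.CFSemigroupResolventPole
import HarnessLib

/-!
# The residue of the resolvent at `δ_A` is nonzero: `m'(δ) = -∫ 2 h log(1/y) dν < 0`

Support file (all results proved) for the named fact
`Literature.NumberTheory.Sieve.MageeOhWinter2019_uniformCounting` (`CFSemigroupCounting.lean`).
`CFSemigroupResolventPole.lean` reduces the pole structure of `(1 - L_s)^{-1}` at `s = δ` to the
non-vanishing of `m'(δ)`, `m(s) = ν(W(s)^{-1} h)`. Here we compute
`m'(δ) = ν(L'_δ h) = -∫ L_δ(2 h log(1/·)) dν = -∫ 2 h(y) log(1/y) dν(y)` and prove that it is a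
negative real number ([MageeOhWinter2019, Prop. 17]: the leading constant of the renewal asymptotic
is `C(x, g) ∝ h(x) ∫ g dν / ∫ τ h dν > 0`; the denominator `∫ τ dμ`, `μ = h ν`, `τ = log|T'|`, is the
Lyapunov exponent / derivative of the pressure, `-P'(δ) > 0`):

* `hasDerivAt_cfM_delta`: `m'(δ) = ν(R₀ L'_δ R₀ h) = ν(L'_δ h)` (derivative of `Ring.inverse`);
* `cfNuL_cfLOpD_cfHL`: `ν(L'_δ h) = -∫ 2 h(y) log(1/max(y, c)) dν(y)` (`c = 1/(B+1)`, a continuous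
  modification of `log(1/y)` away from the range of the branches);
* `cfLyapunov_pos`: `∫ 2 h log(1/max(·, c)) dν > 0` (otherwise `ν = δ₁`, contradicting the
  eigenmeasure relation tested on `f(y) = y` and `f = 1`);
* `deriv_cfM_delta_ne_zero`: hence `m'(δ) ≠ 0`, and `cfResolvent_pole'`: the unconditional pole
  theorem. [cite: MageeOhWinter2019, Prop. 17]

## References

* M. Magee, H. Oh, D. Winter, J. reine angew. Math. 753 (2019) 89–135, Prop. 17, Lemma 16.
  [MageeOhWinter2019]
* S. P. Lalley, Acta Math. 163 (1989) 1–55, Thm. 1 (leading constant `∫ g dν h(x) / δ ∫ τ dμ`).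
-/

noncomputable section

open Set Filter Metric MeasureTheory
open scoped Topology

namespace Literature.NumberTheory.Sieve

variable {A : Finset ℕ}

section Residue

variable (A) (hA : ∀ a ∈ A, 1 ≤ a) (h2 : 2 ≤ A.card)
include hA h2

/-! ### The derivative of `m` at `δ` -/

/-- `s ↦ W(s)` has derivative `-L'_δ` at `δ`. [folklore] -/
theorem hasDerivAt_cfW (s : ℂ) : HasDerivAt (cfW A hA h2) (-cfLOpD A hA s) s := by
  show HasDerivAt (fun s => (1 : CfLip →L[ℂ] CfLip) + cfPi A hA h2 - cfLOp A hA s) (-cfLOpD A hA s) s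
  exact (hasDerivAt_cfLOp A hA s).const_sub _

/-- `s ↦ A(s) = W(s)^{-1}` has derivative `R₀ L'_δ R₀` at `δ`. [folklore] -/
theorem hasDerivAt_cfAinv_delta :
    HasDerivAt (cfAinv A hA h2) (cfR0 A hA h2 * cfLOpD A hA (cfDimension A : ℂ) * cfR0 A hA h2)
      (cfDimension A : ℂ) := by
  have hW : cfW A hA h2 (cfDimension A : ℂ) = (cfOneSubQUnit A hA h2 : CfLip →L[ℂ] CfLip) := by
    rw [cfW_delta]; rfl
  have hinv := hasFDerivAt_ringInverse (𝕜 := ℂ) (cfOneSubQUnit A hA h2)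
  rw [← hW] at hinv
  have h := hinv.comp_hasDerivAt (cfDimension A : ℂ) (hasDerivAt_cfW A hA h2 _)
  have hR : ((cfOneSubQUnit A hA h2)⁻¹ : (CfLip →L[ℂ] CfLip)ˣ) = (cfR0 A hA h2 : CfLip →L[ℂ] CfLip) := rfl
  have hval : (-ContinuousLinearMap.mulLeftRight ℂ (CfLip →L[ℂ] CfLip)
      ((cfOneSubQUnit A hA h2)⁻¹ : (CfLip →L[ℂ] CfLip)ˣ) ((cfOneSubQUnit A hA h2)⁻¹ : (CfLip →L[ℂ] CfLip)ˣ))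
        (-cfLOpD A hA (cfDimension A : ℂ)) =
      cfR0 A hA h2 * cfLOpD A hA (cfDimension A : ℂ) * cfR0 A hA h2 := by
    simp [ContinuousLinearMap.mulLeftRight_apply, hR]
  rw [hval] at h
  exact h

/-- **`m'(δ) = ν(L'_δ h)`** (`ν R₀ = ν`, `R₀ h = h`). [cite: MageeOhWinter2019, Prop. 17] -/
theorem hasDerivAt_cfM_delta :
    HasDerivAt (cfM A hA h2) (cfNuL A hA h2 (cfLOpD A hA (cfDimension A : ℂ) (cfHL A hA h2)))
      (cfDimension A : ℂ) := by
  have h1 := (hasDerivAt_cfAinv_delta A hA h2).clm_apply (hasDerivAt_const (cfDimension A : ℂ) (cfHL A hA h2))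
  simp only [map_zero, add_zero] at h1
  have h2' := (cfNuL A hA h2).hasFDerivAt.comp_hasDerivAt (cfDimension A : ℂ) h1
  have hval : cfNuL A hA h2 ((cfR0 A hA h2 * cfLOpD A hA (cfDimension A : ℂ) * cfR0 A hA h2) (cfHL A hA h2)) =
      cfNuL A hA h2 (cfLOpD A hA (cfDimension A : ℂ) (cfHL A hA h2)) := by
    show cfNuL A hA h2 (cfR0 A hA h2 (cfLOpD A hA (cfDimension A : ℂ) (cfR0 A hA h2 (cfHL A hA h2)))) = _
    rw [cfNuL_cfR0, cfR0_cfHL]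
  rw [hval] at h2'
  exact h2'

/-- `deriv m δ = ν(L'_δ h)`. [folklore] -/
theorem deriv_cfM_delta :
    deriv (cfM A hA h2) (cfDimension A : ℂ) = cfNuL A hA h2 (cfLOpD A hA (cfDimension A : ℂ) (cfHL A hA h2)) :=
  (hasDerivAt_cfM_delta A hA h2).deriv

/-! ### The integrand `2 h(y) log(1/max(y, c))` -/

/-- The cut-off `c = 1/(B+1)` with `B = max A`: all branch points `1/(x+a)` lie above `c`. [folklore] -/
def cfCut : ℝ := 1 / ((A.sup id : ℕ) + 1 : ℝ)

/-- `0 < c ≤ 1/2`. [folklore] -/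
theorem cfCut_pos_le : 0 < cfCut A ∧ cfCut A ≤ 1 / 2 := by
  unfold cfCut
  have hB : (1 : ℝ) ≤ (A.sup id : ℕ) := by
    obtain ⟨a, ha⟩ := nonempty_of_two_le_card h2
    have h1 : a ≤ A.sup id := Finset.le_sup (f := id) ha
    have : (1 : ℝ) ≤ a := by exact_mod_cast hA a ha
    exact this.trans (by exact_mod_cast h1)
  constructor
  · positivity
  · rw [div_le_div_iff₀ (by positivity) (by norm_num)]
    linarith

omit h2 in
/-- The branch points dominate the cut-off: `c ≤ 1/(x+a)` for `x ∈ [0,1]`, `a ∈ A`. [folklore] -/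
theorem cfCut_le_one_div {x : ℝ} (hx : x ∈ Icc (0 : ℝ) 1) {a : ℕ} (ha : a ∈ A) : cfCut A ≤ 1 / (x + a) := by
  unfold cfCut
  have haB : (a : ℝ) ≤ (A.sup id : ℕ) := by exact_mod_cast Finset.le_sup (f := id) ha
  have ha1 : (1 : ℝ) ≤ a := by exact_mod_cast hA a ha
  exact one_div_le_one_div_of_le (by linarith [hx.1]) (by linarith [hx.2])

/-- The integrand `G(y) = 2 h(y) log(1/max(y, c)) = -2 h(y) log(max(y, c))`. [folklore] -/
def cfG (y : ℝ) : ℝ := 2 * cfHδ A hA h2 y * (-Real.log (max y (cfCut A)))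

/-- `G` is continuous on `[0,1]`. [folklore] -/
theorem continuousOn_cfG : ContinuousOn (cfG A hA h2) (Icc 0 1) := by
  have hc := (cfCut_pos_le A hA h2).1
  refine ContinuousOn.mul (continuousOn_const.mul (continuousOn_cfHδ A hA h2)) ?_
  refine ContinuousOn.neg ?_
  refine ContinuousOn.log (continuous_id.max continuous_const).continuousOn fun y _ => ?_
  exact (lt_of_lt_of_le hc (le_max_right _ _)).ne'

/-- `G ≥ 0` on `[0,1]`. [folklore] -/
theorem cfG_nonneg {y : ℝ} (hy : y ∈ Icc (0 : ℝ) 1) : 0 ≤ cfG A hA h2 y := by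
  unfold cfG
  have h1 : 0 ≤ -Real.log (max y (cfCut A)) := by
    rw [neg_nonneg]
    exact Real.log_nonpos (le_max_of_le_right (cfCut_pos_le A hA h2).1.le)
      (max_le hy.2 ((cfCut_pos_le A hA h2).2.trans (by norm_num)))
  have h2' := (cfHδ_pos A hA h2 hy).le
  positivity

/-- `G(y) = 0` forces `y = 1` (for `y ∈ [0,1]`). [folklore] -/
theorem eq_one_of_cfG_eq_zero {y : ℝ} (hy : y ∈ Icc (0 : ℝ) 1) (h0 : cfG A hA h2 y = 0) : y = 1 := by
  unfold cfG at h0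
  have hh := cfHδ_pos A hA h2 hy
  have hc := cfCut_pos_le A hA h2
  have hlog : Real.log (max y (cfCut A)) = 0 := by
    rcases mul_eq_zero.1 h0 with h | h
    · rcases mul_eq_zero.1 h with h' | h'
      · norm_num at h'
      · exact absurd h' hh.ne'
    · linarith
  have hpos : 0 < max y (cfCut A) := lt_of_lt_of_le hc.1 (le_max_right _ _)
  have h1 : max y (cfCut A) = 1 := by
    rcases Real.log_eq_zero.1 hlog with h | h | h
    · exact absurd h hpos.ne'
    · exact h
    · linarith
  have : cfCut A < 1 := by linarith [hc.2]
  rcases le_or_gt y (cfCut A) with hyc | hyc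
  · rw [max_eq_right hyc] at h1; linarith
  · rw [max_eq_left hyc.le] at h1; exact h1

/-- **`L_δ G = -L'_δ h` pointwise:** `Σ_a ((x+a)²)^{-δ} G(1/(x+a)) = Σ_a 2 log(x+a) ((x+a)²)^{-δ} h(1/(x+a))`,
i.e. `(L'_δ h)(x) = -(L_δ G)(x)` on `[0,1]`. [folklore] -/
theorem cfLOpD_cfHL_apply (x : Icc (0 : ℝ) 1) :
    cfLOpD A hA (cfDimension A : ℂ) (cfHL A hA h2) x =
      ((-(cfTransfer A (cfDimension A) (cfG A hA h2) x) : ℝ) : ℂ) := by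
  rw [cfLOpD_apply, cfTransfer, ← Finset.sum_neg_distrib, Complex.ofReal_sum]
  refine Finset.sum_congr rfl fun a ha => ?_
  have ha1 := hA a ha
  have hux := one_div_add_mem_Icc ha1 x.2
  have hd : 0 < cfDenom (cfGen a) x := by
    rw [cfDenom_cfGen]
    have : (1 : ℝ) ≤ a := by exact_mod_cast ha1
    linarith [x.2.1]
  have hxa : 0 < (x : ℝ) + a := by rw [cfDenom_cfGen] at hd; exact hd
  rw [cfWtD, cfWt_ofReal _ _ hd, cfDenom_cfGen, cfHL_extend A hA h2 hux, cfG]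
  have hmax : max (1 / ((x : ℝ) + a)) (cfCut A) = 1 / ((x : ℝ) + a) := max_eq_left (cfCut_le_one_div A hA x.2 ha)
  rw [hmax, one_div, Real.log_inv]
  push_cast
  ring

/-- **`ν(L'_δ h) = -∫ G dν`.** [cite: MageeOhWinter2019, Prop. 17] -/
theorem cfNuL_cfLOpD_cfHL :
    cfNuL A hA h2 (cfLOpD A hA (cfDimension A : ℂ) (cfHL A hA h2)) =
      ((-(cfInt (cfNuδ A hA h2) (cfG A hA h2)) : ℝ) : ℂ) := by
  rw [cfNuL_of_real A hA h2 (g := fun x => -(cfTransfer A (cfDimension A) (cfG A hA h2) x))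
    (fun x => cfLOpD_cfHL_apply A hA h2 x)]
  congr 1
  have h := cfInt_cfTransfer hA (cfNuδ A hA h2) (cfNuδ_eigen A hA h2) (continuousOn_cfG A hA h2)
  rw [cfEig_cfDimension hA h2, one_mul] at h
  rw [← h, cfInt, cfInt, ← integral_neg]

/-! ### Positivity of the Lyapunov integral -/

/-- If `∫ G dν = 0` then `ν`-almost every point is `1`. [folklore] -/
theorem ae_eq_one_of_cfInt_cfG_eq_zero (h0 : cfInt (cfNuδ A hA h2) (cfG A hA h2) = 0) :
    ∀ᵐ x ∂(cfNuδ A hA h2), (x : Icc (0 : ℝ) 1).1 = 1 := by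
  have hint : Integrable (fun x : Icc (0 : ℝ) 1 => cfG A hA h2 x) (cfNuδ A hA h2) :=
    cfIntegrable _ (continuousOn_cfG A hA h2)
  have hnn : 0 ≤ fun x : Icc (0 : ℝ) 1 => cfG A hA h2 x := fun x => cfG_nonneg A hA h2 x.2
  have hae := (integral_eq_zero_iff_of_nonneg hnn hint).1 h0
  filter_upwards [hae] with x hx
  exact eq_one_of_cfG_eq_zero A hA h2 x.2 hx

/-- **The Lyapunov integral is positive:** `∫ 2 h(y) log(1/max(y,c)) dν(y) > 0`. Otherwise `ν` is
the Dirac mass at `1`, and the eigenmeasure relation tested on `f(y) = y` and on `f = 1` gives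
`Σ_a (1+a)^{-2δ}/(1+a) = 1 = Σ_a (1+a)^{-2δ}`, impossible since `1/(1+a) ≤ 1/2`.
[cite: MageeOhWinter2019, Prop. 17] -/
theorem cfInt_cfG_pos : 0 < cfInt (cfNuδ A hA h2) (cfG A hA h2) := by
  have hint : Integrable (fun x : Icc (0 : ℝ) 1 => cfG A hA h2 x) (cfNuδ A hA h2) :=
    cfIntegrable _ (continuousOn_cfG A hA h2)
  have hnn : 0 ≤ cfInt (cfNuδ A hA h2) (cfG A hA h2) := integral_nonneg fun x => cfG_nonneg A hA h2 x.2
  rcases hnn.lt_or_eq with hpos | heq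
  · exact hpos
  exfalso
  have hae := ae_eq_one_of_cfInt_cfG_eq_zero A hA h2 heq.symm
  -- integrals against `ν` are evaluations at `1`
  have h1I : (1 : ℝ) ∈ Icc (0 : ℝ) 1 := ⟨zero_le_one, le_rfl⟩
  have heval : ∀ f : C(Icc (0 : ℝ) 1, ℝ), ∫ x, f x ∂(cfNuδ A hA h2) = f ⟨1, h1I⟩ := by
    intro f
    have h : (fun x : Icc (0 : ℝ) 1 => f x) =ᵐ[cfNuδ A hA h2] fun _ => f ⟨1, h1I⟩ := by
      filter_upwards [hae] with x hx
      congr 1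
      exact Subtype.ext hx
    rw [integral_congr_ae h]
    simp
  -- the eigen-relation at `1` for a continuous `f`
  have heig1 : ∀ f : C(Icc (0 : ℝ) 1, ℝ), cfTransfer A (cfDimension A) (cfExtend f) 1 = f ⟨1, h1I⟩ := by
    intro f
    have h := cfNuδ_eigen A hA h2 f
    rw [cfEig_cfDimension hA h2, one_mul, heval, heval] at h
    rw [cfTransferC_apply] at h
    exact h
  -- test functions `f₁ = 1` and `f₂ = id`
  let f₁ : C(Icc (0 : ℝ) 1, ℝ) := ⟨fun _ => 1, continuous_const⟩
  let f₂ : C(Icc (0 : ℝ) 1, ℝ) := ⟨fun x => (x : ℝ), continuous_subtype_val⟩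
  have hf₁ := heig1 f₁
  have hf₂ := heig1 f₂
  have e₁ : cfTransfer A (cfDimension A) (cfExtend f₁) 1 = ∑ a ∈ A, (((1 : ℝ) + a) ^ 2) ^ (-cfDimension A) := by
    rw [cfTransfer]
    refine Finset.sum_congr rfl fun a ha => ?_
    rw [cfExtend_of_mem _ (one_div_add_mem_Icc (hA a ha) h1I)]
    show ((1 + (a : ℝ)) ^ 2) ^ (-cfDimension A) * 1 = _
    rw [mul_one]
  have e₂ : cfTransfer A (cfDimension A) (cfExtend f₂) 1 =
      ∑ a ∈ A, (((1 : ℝ) + a) ^ 2) ^ (-cfDimension A) * (1 / (1 + a)) := by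
    rw [cfTransfer]
    refine Finset.sum_congr rfl fun a ha => ?_
    rw [cfExtend_of_mem _ (one_div_add_mem_Icc (hA a ha) h1I)]
    rfl
  rw [e₁] at hf₁
  rw [e₂] at hf₂
  have hv₁ : f₁ ⟨1, h1I⟩ = 1 := rfl
  have hv₂ : f₂ ⟨1, h1I⟩ = 1 := rfl
  rw [hv₁] at hf₁
  rw [hv₂] at hf₂
  -- `Σ w_a/(1+a) ≤ (1/2) Σ w_a = 1/2 < 1`
  have hle : ∑ a ∈ A, (((1 : ℝ) + a) ^ 2) ^ (-cfDimension A) * (1 / (1 + a)) ≤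
      ∑ a ∈ A, (((1 : ℝ) + a) ^ 2) ^ (-cfDimension A) * (1 / 2) := by
    refine Finset.sum_le_sum fun a ha => mul_le_mul_of_nonneg_left ?_ (Real.rpow_nonneg (sq_nonneg _) _)
    have ha1 : (1 : ℝ) ≤ a := by exact_mod_cast hA a ha
    exact one_div_le_one_div_of_le (by norm_num) (by linarith)
  rw [← Finset.sum_mul, hf₁, one_mul] at hle
  linarith

/-- **`m'(δ) = -∫ G dν < 0`; in particular `m'(δ) ≠ 0`.** [cite: MageeOhWinter2019, Prop. 17] -/
theorem deriv_cfM_delta_eq :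
    deriv (cfM A hA h2) (cfDimension A : ℂ) = ((-(cfInt (cfNuδ A hA h2) (cfG A hA h2)) : ℝ) : ℂ) := by
  rw [deriv_cfM_delta, cfNuL_cfLOpD_cfHL]

/-- **The residue coefficient is nonzero:** `deriv m δ ≠ 0`. [cite: MageeOhWinter2019, Prop. 17] -/
theorem deriv_cfM_delta_ne_zero : deriv (cfM A hA h2) (cfDimension A : ℂ) ≠ 0 := by
  rw [deriv_cfM_delta_eq, Ne, Complex.ofReal_eq_zero, neg_eq_zero]
  exact (cfInt_cfG_pos A hA h2).ne'

/-- **The simple pole of the resolvent at `δ_A`, unconditionally** ([MageeOhWinter2019, Prop. 17] in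
operator form; the analytic input of Lalley's renewal theorem for `Γ_A`): there are `ε > 0` and an
operator-valued `W_reg`, analytic on `B(δ, ε)`, such that for `0 < |s - δ| < ε`, `1 - L_s` is
invertible on the Lipschitz space with inverse
`W_reg(s) + ((s - δ) ∫ 2 h log(1/·) dν)^{-1} Π` (residue `Π / ∫ 2 h log(1/·) dν`, a positive multiple
of the spectral projection). [cite: MageeOhWinter2019, Prop. 17] -/
theorem cfResolvent_pole' :
    ∃ ε > 0, ∃ Wreg : ℂ → (CfLip →L[ℂ] CfLip),
      (∀ s ∈ ball (cfDimension A : ℂ) ε, AnalyticAt ℂ Wreg s) ∧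
      ∀ s ∈ ball (cfDimension A : ℂ) ε, s ≠ (cfDimension A : ℂ) →
        (1 - cfLOp A hA s) *
            (Wreg s + ((s - cfDimension A)⁻¹ * ((cfInt (cfNuδ A hA h2) (cfG A hA h2) : ℝ) : ℂ)⁻¹) • cfPi A hA h2) = 1 ∧
        (Wreg s + ((s - cfDimension A)⁻¹ * ((cfInt (cfNuδ A hA h2) (cfG A hA h2) : ℝ) : ℂ)⁻¹) • cfPi A hA h2) *
            (1 - cfLOp A hA s) = 1 := by
  obtain ⟨ε, hε, Wreg, han, hinv⟩ := cfResolvent_pole A hA h2 (deriv_cfM_delta_ne_zero A hA h2)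
  refine ⟨ε, hε, Wreg, han, fun s hs hne => ?_⟩
  have h := hinv s hs hne
  rw [deriv_cfM_delta_eq] at h
  have e : Wreg s - ((s - cfDimension A)⁻¹ * (((-(cfInt (cfNuδ A hA h2) (cfG A hA h2)) : ℝ) : ℂ))⁻¹) • cfPi A hA h2 =
      Wreg s + ((s - cfDimension A)⁻¹ * ((cfInt (cfNuδ A hA h2) (cfG A hA h2) : ℝ) : ℂ)⁻¹) • cfPi A hA h2 := by
    rw [Complex.ofReal_neg, inv_neg, mul_neg, neg_smul, sub_neg_eq_add]
  rw [e] at h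
  exact h

end Residue

end Literature.NumberTheory.Sieve
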